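import Mathlib.CategoryTheory.Core
import Literature.IUT.LogThetaLattice.RadialData
import HarnessLib

/-!
# [IUTchIII] Cor 2.3: radial and coric data as FUNCTORS on cores (companion to `RadialData.lean`)

Mochizuki, *Inter-universal Teichmüller Theory III*, kurims manuscript (May 2020), §2, Cor 2.3 pp.72–75
[cite: Mochizuki2012, III Cor 2.3 pp.72–75] (D-0012 claim key, status disputed; bookkeeping over the interface
`ThetaCoricData` of `RadialData.lean`, nothing asserted).

`RadialData.lean` types Cor 2.3's radial data `†ℜ` (determined by (a_ℜ) the `D-Θ^{±ell}NF`-Hodge theater)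
and coric data `†ℭ` (determined by (a_ℭ) the `D^⊢`-prime-strip) as groupoids `Radial E`, `Coric E`, the
radial algorithm `Φ` as the functor `radialAlgorithm E`, and "each `D-Θ^{±ell}NF`-Hodge theater … defines, in
an evident way, an associated collection of radial data" (Cor 2.3 (ii) p.74) object-wise (`latticeRadial`) with
`Radial.Hom.ofDHT` on isomorphisms. This companion packages the "evident way" as FUNCTORS on the cores
(groupoids of isomorphisms; Mathlib `CategoryTheory.Core`):
* `Radial.coreFunctor E : Core S.DHT ⥤ Radial E` — `X ↦ ^{X}ℜ`, an isomorphism of `D`-Hodge theaters `ξ` ↦ the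
  morphism of radial data `(ξ, F^{⊢×μ}_△(D^⊢_△(ξ)))` (`Radial.Hom.ofDHT`);
* `Coric.coreFunctor E : Core S.Dv ⥤ Coric E` — `†D^⊢ ↦ (†D^⊢, F^{⊢×μ}(†D^⊢))`, `d ↦ (d, F^{⊢×μ}(d))`;
* `Radial.coreFunctorRadialAlgorithmIso` — `Φ ∘ (X ↦ ^{X}ℜ) ≅ (†D^⊢ ↦ †ℭ) ∘ Core(†HT^D ↦ †D^⊢_△)` with identity
  components (PROVED: the `D^⊢`-isomorphism induced by `Hom.ofDHT ξ` is `D^⊢_△(ξ)`, `Radial.inducedDv_ofDHT`).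
Requested by abc-iut-c312-1 (INBOX 2026-08-25T21:22:27Z) as the functorial radial-data input `FR` of
`Summits/ABC/IUTFork/Thm311LinkLattice.LinkData.ofFunctorsCore` (Thm 3.11 (iii)).
-/

namespace Literature.IUT.LogThetaLattice

open CategoryTheory
open Literature.IUT.HodgeTheaters

universe u

variable {S : StripFrame.{u}} (E : ThetaCoricData S)

namespace Radial

/-- **IUTchIII:Cor2.3(ii)** (kurims p.74) "Each `D-Θ^{±ell}NF`-Hodge theater … defines, in an evident way, an associated
collection of radial data", FUNCTORIALLY in the isomorphisms of `D`-Hodge theaters: the functor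
`Core(†HT^D) ⥤ ℜ`, `X ↦ (a_ℜ) X`, `ξ ↦ (ξ, F^{⊢×μ}_△(D^⊢_△(ξ)))` (`Hom.ofDHT`). [claim: Mochizuki2012, status: disputed] -/
def coreFunctor : Core S.DHT ⥤ Radial E where
  obj X := ⟨X.of⟩
  map f := Hom.ofDHT f.iso
  map_id X := by
    apply Radial.hom_ext
    · simp only [Hom.ofDHT, coreCategory_id_iso, id_ξ]
    · simp only [Hom.ofDHT, coreCategory_id_iso, Functor.mapIso_refl, id_δ]
  map_comp f g := by
    apply Radial.hom_ext
    · simp only [Hom.ofDHT, coreCategory_comp_iso, comp_ξ]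
    · simp only [Hom.ofDHT, coreCategory_comp_iso, Functor.mapIso_trans, comp_δ]

/-- **IUTchIII:Cor2.3(ii)** (kurims p.74) the radial datum of `X` is `(a_ℜ) = X`. [claim: Mochizuki2012, status: disputed] -/
@[simp] theorem coreFunctor_obj_ht (X : Core S.DHT) : ((coreFunctor E).obj X).ht = X.of := rfl

/-- **IUTchIII:Cor2.3(ii)** (kurims p.74) the induced morphism is `Hom.ofDHT` of the underlying isomorphism.
[claim: Mochizuki2012, status: disputed] -/
theorem coreFunctor_map {X Y : Core S.DHT} (f : X ⟶ Y) :
    (coreFunctor E).map f = Hom.ofDHT (R := ⟨X.of⟩) (R' := ⟨Y.of⟩) f.iso := rfl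

/-- **IUTchIII:Cor2.3(ii)** (kurims p.74) (a_{Morℜ}) of the induced morphism is the isomorphism itself.
[claim: Mochizuki2012, status: disputed] -/
@[simp] theorem coreFunctor_map_ξ {X Y : Core S.DHT} (f : X ⟶ Y) : ((coreFunctor E).map f).ξ = f.iso := rfl

/-- **IUTchIII:Cor2.3(ii)** (kurims p.74) (d_{Morℜ}) of the induced morphism is `F^{⊢×μ}_△(D^⊢_△(ξ))`.
[claim: Mochizuki2012, status: disputed] -/
@[simp] theorem coreFunctor_map_δ {X Y : Core S.DHT} (f : X ⟶ Y) :
    ((coreFunctor E).map f).δ = E.fxmOfDv.mapIso (E.dvDelta.mapIso f.iso) := rfl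

/-- **IUTchIII:Cor2.3(ii)** (kurims p.74) on a `ℤ × ℤ`-family of `D`-Hodge theaters the functor's objects are the
`^{n,m}ℜ` of `latticeRadial`. [claim: Mochizuki2012, status: disputed] -/
theorem coreFunctor_obj_lattice (H : ℤ × ℤ → S.DHT) (p : ℤ × ℤ) :
    (coreFunctor E).obj ⟨H p⟩ = latticeRadial E H p := rfl

/-- **IUTchIII:Cor2.3** (kurims p.73) the `D^⊢`-isomorphism `†D^⊢_△ ⥲ ‡D^⊢_△` induced (through (d_{Morℜ}) and
`D^⊢(F^{⊢×μ}(−)) = (−)`) by the morphism `Hom.ofDHT ξ` is `D^⊢_△(ξ)` — naturality of `ThetaCoricData.dvIso`.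
[claim: Mochizuki2012, status: disputed] -/
theorem inducedDv_ofDHT {R R' : Radial E} (ξ : R.ht ≅ R'.ht) :
    Radial.Hom.inducedDv E (Hom.ofDHT ξ) = E.dvDelta.mapIso ξ := by
  rw [Radial.Hom.inducedDv]
  change (E.dvIso _).symm ≪≫ S.FxmToDv.mapIso (E.fxmOfDv.mapIso (E.dvDelta.mapIso ξ)) ≪≫ E.dvIso _ = _
  rw [E.mapIso_fxmOfDv_dv]
  simp only [Iso.trans_assoc, Iso.symm_self_id, Iso.trans_refl, Iso.symm_self_id_assoc]

end Radial

namespace Coric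

/-- **IUTchIII:Cor2.3** (kurims p.73) coric data FUNCTORIALLY in the isomorphisms of `D^⊢`-prime-strips:
`Core(†D^⊢) ⥤ ℭ`, `†D^⊢ ↦ (†D^⊢, F^{⊢×μ}(†D^⊢))`, `d ↦ (d, F^{⊢×μ}(d))` ("(b) induces (a)" by
`ThetaCoricData.mapIso_fxmOfDv_dv`). [claim: Mochizuki2012, status: disputed] -/
def coreFunctor : Core S.Dv ⥤ Coric E where
  obj X := ⟨X.of⟩
  map f := ⟨f.iso, E.fxmOfDv.mapIso f.iso, E.mapIso_fxmOfDv_dv f.iso⟩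
  map_id X := by
    apply Coric.hom_ext
    · simp only [coreCategory_id_iso, id_d]
    · simp only [coreCategory_id_iso, Functor.mapIso_refl, id_δ]
  map_comp f g := by
    apply Coric.hom_ext
    · simp only [coreCategory_comp_iso, comp_d]
    · simp only [coreCategory_comp_iso, Functor.mapIso_trans, comp_δ]

/-- **IUTchIII:Cor2.3** (kurims p.73) (a_ℭ) of the coric datum of `†D^⊢` is `†D^⊢`. [claim: Mochizuki2012, status: disputed] -/
@[simp] theorem coreFunctor_obj_dv (X : Core S.Dv) : ((coreFunctor E).obj X).dv = X.of := rfl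

/-- **IUTchIII:Cor2.3** (kurims p.73) (a_{Morℭ}) of the induced morphism. [claim: Mochizuki2012, status: disputed] -/
@[simp] theorem coreFunctor_map_d {X Y : Core S.Dv} (f : X ⟶ Y) : ((coreFunctor E).map f).d = f.iso := rfl

/-- **IUTchIII:Cor2.3** (kurims p.73) (b_{Morℭ}) of the induced morphism. [claim: Mochizuki2012, status: disputed] -/
@[simp] theorem coreFunctor_map_δ {X Y : Core S.Dv} (f : X ⟶ Y) :
    ((coreFunctor E).map f).δ = E.fxmOfDv.mapIso f.iso := rfl

end Coric

/-- **IUTchIII:Cor2.3** (kurims p.73) COMPATIBILITY of the functorial packagings with the radial algorithm `Φ`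
at one morphism: `Φ((ξ, F^{⊢×μ}_△(D^⊢_△(ξ)))) = (D^⊢_△(ξ), F^{⊢×μ}_△(D^⊢_△(ξ)))` as morphisms of coric data
(`Radial.inducedDv_ofDHT`). [claim: Mochizuki2012, status: disputed] -/
theorem Radial.radialAlgorithm_map_coreFunctor {X Y : Core S.DHT} (f : X ⟶ Y) :
    (radialAlgorithm E).map ((Radial.coreFunctor E).map f) =
      (Coric.coreFunctor E).map (E.dvDelta.core.map f) := by
  apply Coric.hom_ext
  · rw [radialAlgorithm_map_d]
    refine (Radial.inducedDv_ofDHT E (R := (Radial.coreFunctor E).obj X)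
      (R' := (Radial.coreFunctor E).obj Y) f.iso).trans ?_
    exact Iso.ext rfl
  · exact Iso.ext rfl

/-- **IUTchIII:Cor2.3** (kurims p.73) the same as a natural isomorphism with identity components:
`Φ ∘ (X ↦ ^{X}ℜ) ≅ (†D^⊢ ↦ †ℭ) ∘ Core(†HT^D ↦ †D^⊢_△)`. [claim: Mochizuki2012, status: disputed] -/
def Radial.coreFunctorRadialAlgorithmIso :
    Radial.coreFunctor E ⋙ radialAlgorithm E ≅ E.dvDelta.core ⋙ Coric.coreFunctor E :=
  NatIso.ofComponents (fun _ => Iso.refl _) (by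
    intro X Y f
    change (radialAlgorithm E).map ((Radial.coreFunctor E).map f) ≫ 𝟙 _ =
      𝟙 ((Coric.coreFunctor E).obj (E.dvDelta.core.obj X)) ≫ (Coric.coreFunctor E).map (E.dvDelta.core.map f)
    rw [Category.comp_id, Category.id_comp]
    exact Radial.radialAlgorithm_map_coreFunctor E f)

end Literature.IUT.LogThetaLattice
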